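import Summits.AtomisticToContinuum.HydrodynamicLimit.Theses.OneFlightGossipEngine
import HarnessLib

/-!
# Shape of the dock `ClampedTransferDock` (stmt-AtomisticToContinuum-16665; since route rev 29 stmt-17615): irrefutable short of `¬ HydrodynamicLimit`

Negative helper file of the crux disprover (`--supports stmt-AtomisticToContinuum-16665`; work file
`Cruxes/ClampedTransferDock/Disproof.lean`). No Theses declaration is asserted positively.

* `not_clampedTransferDock_iff` — the negation of the dock is its four antecedents together with the negation of the summit
  conjunct: a refutation of the dock is a refutation of `HydrodynamicLimit` (`not_hydrodynamicLimit_of_not_clampedTransferDock`),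
  so no counterexample search can bite and no `_false_without_<H>` lemma (one antecedent dropped) can exist.
* `not_dockWithoutDSC_of_not_clampedTransferDock` — a refutation would in particular refute the STRONGER dock with the antecedent
  `DiluteSelfConsistency` (stmt-3091) dropped; that stronger dock is what the heart line actually proves (companion file
  `Negative/DockWithoutDSC.lean`: `DiluteSelfConsistency` is idle since the D-0032 re-type made the packing guard a hypothesis of
  the conjunct).

refuter-cdisprove-stmt-AtomisticToContinuum-16665-0, 2026-08-16.

Maintenance record (full-build repair, 2026-08-17).  The four theorems were written against route rev 25, where the
gate-written `Theses.OneFlightGossipEngine.ClampedTransferDock` was stmt-AtomisticToContinuum-16665,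
`KineticCurrentsLDAlongFamilies → CollisionActivityTails → EnergyCurrentTails → DiluteSelfConsistency → HydrodynamicLimit`
(four antecedents, as the first bullet says).  Route rev 29 (2026-08-16T23:23:53Z, route-repair rrepair-07645bdd
after the statement re-type D-0032 / p126922) retired 16665 and restated the dock DSC-FREE under the SAME name
(stmt-AtomisticToContinuum-17615, `KineticCurrentsLDAlongFamilies → CollisionActivityTails → EnergyCurrentTails →
HydrodynamicLimit`) — exactly the "dock without DSC" of the second bullet, the restatement acting on the finding
recorded here — after which the first three theorems no longer elaborated (full build 2026-08-17T00:13Z).  Since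
rev 29 every `ClampedTransferDock` in this file denotes the LIVE dock.  Repair, declaration by declaration (Theorems
files are append-only: a statement is kept, or deprecated, never silently edited; nothing is added or removed):
* `not_hydrodynamicLimit_of_not_clampedTransferDock` — statement unchanged, now about the live dock (proof: three
  binders instead of four); `Theorems/ClampedCurrentsDock/Negative/RefutationReducesToStatement.lean` relies on
  exactly this reading and does not restate it.
* `not_dockWithoutDSC_of_not_clampedTransferDock` — statement unchanged; since rev 29 its conclusion is the unfolding
  of its hypothesis (proof: unfold), kept as the record of the rev-25 finding "the DSC-free dock is the stronger,
  actually-proved statement".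
* `not_dockWithoutDSC_iff` — untouched; it is now, up to unfolding `ClampedTransferDock`, the shape lemma of the live
  dock (the route docstring of `ClampedTransferDock` cites it by name).
* `not_clampedTransferDock_iff` — the one statement that cannot stand (its right-hand side carried the retired conjunct
  `DiluteSelfConsistency`): deprecated alias of `not_dockWithoutDSC_iff`, i.e. the live shape with the dock unfolded;
  the folded form `¬ ClampedTransferDock ↔ …` is the landed
  `Summit.AtomisticToContinuum.HydrodynamicLimit.Theorems.clampedTransferDock_not_iff` of
  `RefutationReducesToStatement.lean` and is not duplicated here.
-/

namespace Summit.AtomisticToContinuum.HydrodynamicLimit.Theorems.ClampedTransferDockNegative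

open Summit.AtomisticToContinuum.HydrodynamicLimit.Theses.OneFlightGossipEngine

/-- Any refutation of the dock refutes the summit conjunct (live dock, route rev 29, stmt-AtomisticToContinuum-17615:
three antecedents; written at rev 25 for the four-antecedent stmt-16665, same statement). [folklore] -/
theorem not_hydrodynamicLimit_of_not_clampedTransferDock (h : ¬ ClampedTransferDock) : ¬ _root_.HydrodynamicLimit :=
  fun hH => h fun _ _ _ => hH

/-- A refutation of the crux refutes the DSC-free dock
`KineticCurrentsLDAlongFamilies → CollisionActivityTails → EnergyCurrentTails → HydrodynamicLimit`.  At route rev 25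
(stmt-16665, antecedent `DiluteSelfConsistency` present) this was the passage to a strictly STRONGER dock — the finding
the rev-29 restatement (stmt-17615) acted on; since then the crux IS this implication, so the conclusion is the
unfolding of the hypothesis and the lemma is kept, trivially true, as the record of that finding. [folklore] -/
theorem not_dockWithoutDSC_of_not_clampedTransferDock (h : ¬ ClampedTransferDock) :
    ¬ (KineticCurrentsLDAlongFamilies → CollisionActivityTails → EnergyCurrentTails → _root_.HydrodynamicLimit) := by
  simp only [ClampedTransferDock] at h
  exact h

/-- Shape of the DSC-free dock: its negation is the three remaining antecedents with `¬ HydrodynamicLimit`. [folklore] -/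
theorem not_dockWithoutDSC_iff :
    ¬ (KineticCurrentsLDAlongFamilies → CollisionActivityTails → EnergyCurrentTails → _root_.HydrodynamicLimit) ↔
      (KineticCurrentsLDAlongFamilies ∧ CollisionActivityTails ∧ EnergyCurrentTails ∧ ¬ _root_.HydrodynamicLimit) := by
  simp only [Classical.not_imp]

/-- **The dock is irrefutable short of the conjunct** — rev-25 name.  Stated at rev 25 as
`¬ ClampedTransferDock ↔ (KineticCurrentsLDAlongFamilies ∧ CollisionActivityTails ∧ EnergyCurrentTails ∧
DiluteSelfConsistency ∧ ¬ HydrodynamicLimit)` for the four-antecedent dock stmt-AtomisticToContinuum-16665; the live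
dock (rev 29, stmt-17615) has no antecedent `DiluteSelfConsistency`, so that statement left with the item and the
name is kept (append-only) as a deprecated alias of the live shape lemma `not_dockWithoutDSC_iff` (the dock unfolded;
folded form: `Summit.AtomisticToContinuum.HydrodynamicLimit.Theorems.clampedTransferDock_not_iff`). [folklore] -/
@[deprecated not_dockWithoutDSC_iff (since := "2026-08-17")]
alias not_clampedTransferDock_iff := not_dockWithoutDSC_iff

end Summit.AtomisticToContinuum.HydrodynamicLimit.Theorems.ClampedTransferDockNegative
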